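import Literature.MathematicalPhysics.QuantumFieldTheory.Balaban1983to89.T4ShellMeasure

/-!
# `T4Continuum.ShellMeasureTranslate` — the ENGINE of member (τ) of the NE7c shell-measure frame: SPARSE
# TRANSLATES + FORWARD COMPARISON (a Wegner ∕ Stollmann-shaped estimate), exit above the shell, grid count, menu,
# and the assembly into `SlotAntiConcentration` BY NAME
# (cell `pub-balaban`, sub-cell `t4`, spine estimate NE7c (node U5b); EXECUTOR: lineage t4-ne7c-p1 = PROVER seat P1
# «shell-measure route», generation 21, row-NE7c owner; ORIGIN: adapted from the NE7 ideation seat's kernel-checked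
# scratch `HOME/t4/b2b-balaban-t4-ne7-p2/g25/Sketch.lean` sha16 1410a88ea3e43b0d (lineage t4-ne7-p2, gen 25, memo
# `IDEAS-NE7-g25.md` 6964dd430aaf9a72 — route (M1)-τ), with the sparsity hypothesis restated as an INDICATOR SUM (no
# decidability instance in the statements); companion `ShellMeasureTranslateBond` = the memo's steps S1–S4 over the
# realized configuration space; tree target `Summits/QuantumFields/BalabanUV/T4Continuum/Support/`; ADDITIVE —
# imports `T4ShellMeasure` only and modifies nothing)

HONEST FRAMING.  Finite four-torus programme, rung (B)+1 only — NOT infinite volume, NOT a mass gap, NOT the Clay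
problem, NOT summit progress; (B), `BetaPertHyp`, (B^μ) are not mentioned because nothing here consumes them.  The
cell wall of NE7c — (M1) `T4ShellMeasure.SlotAntiConcentration` FOR BAŁABAN'S INDUCTIVELY DEFINED EFFECTIVE MEASURES —
is NOT PRINTED in [Balaban 1983–89] (GAPS G-ne7cp1-1), asserted by nobody, and NOT moved by this file.  Every
declaration is [folklore] kernel mathematics (one change of variables per translate, finite combinatorics, one real
inequality), 0 sorry, 0 citations; NOTHING of Bałaban's densities, minimisers or response kernels is asserted.

THE ENGINE (memo §1 (E1)–(E6)).  `e i` (`i ∈ ι`, finite) measure-preserving automorphisms of `(Ω, μ₀)` — the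
translates of ONE block bond along a grid of parameters; `f` the density; `S` a shell piece.  If `f x ≤ C·f(e_i x)` on
`S` (FORWARD COMPARISON) and every point is reached from `S` by at most `N` translates (SPARSITY), then
`|ι|·∫_S f ≤ C·N·∫ f` (§1 `card_mul_setLIntegral_le`, `withDensity_le_fraction`).  Sparsity comes from the EXIT: the
ACTIVE plaquette's functional obeys a one-sided expansion `g(s) ≥ g(0) + κs − C₂s²` and is dominated by the sup-type
tested variable, so the orbit leaves the shell upwards within `ℓ = 2ρθ/κ` and stays above on a window (§2
`exit_above`, `gap_of_exit`), whence at most `⌊ℓ/δ⌋ + 1` points of any grid of mesh `δ` spanning `≤ ℓ + w` visit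
the piece (`grid_count_le`).  §3 holds the two finite selection lemmas behind the MENU of (nearby bond, signed
Lie-algebra direction) (`exists_coord_sq_ge`, `exists_large_entry` — the located input (T1) in its weakest form), §4
the union over the menu (`slotAntiConcentration_of_menu`, `slotAntiConcentration_of_translates`: (M1) BY NAME with
`D = |M|·(C·N/|ι|)/ρ` from exactly `hcover`, `hmono`, `hsparse`).

LOCATED, NOT PRINTED (they stay hypotheses here and in the companion): (T1)∕(T1′) the one-sided transversality at the
active plaquette for the best nearby bond (the member's only non-degeneracy input); (T2)+(T4) the forward
log-Lipschitz rate of the sectioned density along one bond (printed TYPE; the same first-order quantity as `ℓ_j` of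
GAPS G-ne7cp1-22); the assignment.  NE7c NOT proved.
-/

namespace Summit.QuantumFields.BalabanUV.T4Continuum.ShellMeasureTranslate

open MeasureTheory Set Function Finset
open scoped ENNReal
open Literature.MathematicalPhysics.QuantumFieldTheory.Balaban1983to89
open T4ShellMeasure (SlotAntiConcentration)

/-! ## §1 Sparse translates: the measure-preserving change of variables (engine of `g25/Sketch.lean` §1) -/

section SparseTranslates

variable {Ω ι : Type*} [MeasurableSpace Ω] [Fintype ι]

omit [MeasurableSpace Ω] [Fintype ι] in
/-- pointwise: a translated indicator of `f` is the translated indicator of `1` times `f`. [folklore] -/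
theorem indicator_preimage_eq_mul (T : Set Ω) (f : Ω → ℝ≥0∞) (y : Ω) :
    T.indicator f y = T.indicator (fun _ => (1 : ℝ≥0∞)) y * f y := by
  by_cases h : y ∈ T
  · rw [indicator_of_mem h, indicator_of_mem h, one_mul]
  · rw [indicator_of_notMem h, indicator_of_notMem h, zero_mul]

/-- **SPARSE TRANSLATES LEMMA.**  `e i` (`i ∈ ι`, finite) are measure-preserving automorphisms of `(Ω, μ₀)`
(«translates along one bond by the grid parameters»), `f ≥ 0` a measurable density, `S` a measurable set (a shell
piece).  If (forward comparison) `f x ≤ C·f(e_i x)` for `x ∈ S` and all `i`, and (sparsity) every point `y` is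
reached from `S` by at most `N` of the translates — `Σ_i 1_{(e_i)⁻¹ y ∈ S} ≤ N` — then
`|ι|·∫_S f dμ₀ ≤ C·N·∫ f dμ₀`.  One change of variables per translate and one pointwise count; no disintegration.
[folklore] -/
theorem card_mul_setLIntegral_le (μ₀ : Measure Ω) (e : ι → Ω ≃ᵐ Ω) (he : ∀ i, MeasurePreserving (e i) μ₀ μ₀)
    {f : Ω → ℝ≥0∞} (hf : Measurable f) {S : Set Ω} (hS : MeasurableSet S) (C : ℝ≥0∞) (N : ℕ)
    (hmono : ∀ i, ∀ x ∈ S, f x ≤ C * f (e i x))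
    (hsparse : ∀ y, ∑ i, ((e i).symm ⁻¹' S).indicator (fun _ => (1 : ℝ≥0∞)) y ≤ N) :
    (Fintype.card ι : ℝ≥0∞) * ∫⁻ x in S, f x ∂μ₀ ≤ C * N * ∫⁻ x, f x ∂μ₀ := by
  have h1 : (Fintype.card ι : ℝ≥0∞) * ∫⁻ x in S, f x ∂μ₀ = ∑ _i : ι, ∫⁻ x, S.indicator f x ∂μ₀ := by
    rw [sum_const, nsmul_eq_mul, Finset.card_univ, lintegral_indicator hS]
  have h2 : ∀ i, ∫⁻ x, S.indicator f x ∂μ₀ ≤ C * ∫⁻ y, ((e i).symm ⁻¹' S).indicator f y ∂μ₀ := by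
    intro i
    have hpt : ∀ x, S.indicator f x ≤ C * ((e i).symm ⁻¹' S).indicator f (e i x) := by
      intro x
      by_cases hx : x ∈ S
      · have hx' : e i x ∈ (e i).symm ⁻¹' S := by
          show (e i).symm (e i x) ∈ S
          simpa using hx
        rw [indicator_of_mem hx, indicator_of_mem hx']
        exact hmono i x hx
      · rw [indicator_of_notMem hx]
        exact bot_le
    calc ∫⁻ x, S.indicator f x ∂μ₀
        ≤ ∫⁻ x, C * ((e i).symm ⁻¹' S).indicator f (e i x) ∂μ₀ := lintegral_mono hpt
      _ = C * ∫⁻ x, ((e i).symm ⁻¹' S).indicator f (e i x) ∂μ₀ := by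
          rw [lintegral_const_mul'' _ ?_]
          exact ((hf.indicator (hS.preimage (e i).symm.measurable)).comp (e i).measurable).aemeasurable
      _ = C * ∫⁻ y, ((e i).symm ⁻¹' S).indicator f y ∂μ₀ := by
          rw [(he i).lintegral_comp_emb (e i).measurableEmbedding]
  have hmeas : ∀ i ∈ (univ : Finset ι), Measurable fun y => ((e i).symm ⁻¹' S).indicator f y :=
    fun i _ => hf.indicator (hS.preimage (e i).symm.measurable)
  calc (Fintype.card ι : ℝ≥0∞) * ∫⁻ x in S, f x ∂μ₀
      = ∑ _i : ι, ∫⁻ x, S.indicator f x ∂μ₀ := h1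
    _ ≤ ∑ i : ι, C * ∫⁻ y, ((e i).symm ⁻¹' S).indicator f y ∂μ₀ := sum_le_sum fun i _ => h2 i
    _ = C * ∫⁻ y, ∑ i : ι, ((e i).symm ⁻¹' S).indicator f y ∂μ₀ := by
        rw [← mul_sum, lintegral_finsetSum _ hmeas]
    _ = C * ∫⁻ y, (∑ i : ι, ((e i).symm ⁻¹' S).indicator (fun _ => (1 : ℝ≥0∞)) y) * f y ∂μ₀ := by
        congr 1
        refine lintegral_congr fun y => ?_
        rw [sum_mul]
        exact sum_congr rfl fun i _ => indicator_preimage_eq_mul _ f y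
    _ ≤ C * ∫⁻ y, (N : ℝ≥0∞) * f y ∂μ₀ := by
        gcongr with y
        exact hsparse y
    _ = C * N * ∫⁻ x, f x ∂μ₀ := by
        rw [lintegral_const_mul'' _ hf.aemeasurable, mul_assoc]

/-- The same bound for the measure with density `f`, as a FRACTION of its total mass:
`(μ₀.withDensity f) S ≤ ofReal (C·N/|ι|) · (μ₀.withDensity f) univ`. [folklore] -/
theorem withDensity_le_fraction (μ₀ : Measure Ω) (e : ι → Ω ≃ᵐ Ω) (he : ∀ i, MeasurePreserving (e i) μ₀ μ₀)
    {f : Ω → ℝ≥0∞} (hf : Measurable f) {S : Set Ω} (hS : MeasurableSet S) {C : ℝ} (hC : 0 ≤ C) (N : ℕ)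
    (hι : 0 < Fintype.card ι) (hmono : ∀ i, ∀ x ∈ S, f x ≤ ENNReal.ofReal C * f (e i x))
    (hsparse : ∀ y, ∑ i, ((e i).symm ⁻¹' S).indicator (fun _ => (1 : ℝ≥0∞)) y ≤ N) :
    μ₀.withDensity f S ≤ ENNReal.ofReal (C * N / Fintype.card ι) * μ₀.withDensity f univ := by
  have hmain := card_mul_setLIntegral_le μ₀ e he hf hS (ENNReal.ofReal C) N hmono hsparse
  rw [withDensity_apply _ hS, withDensity_apply _ MeasurableSet.univ, Measure.restrict_univ]
  have hk0 : (Fintype.card ι : ℝ≥0∞) ≠ 0 := by exact_mod_cast hι.ne'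
  have hktop : (Fintype.card ι : ℝ≥0∞) ≠ ∞ := ENNReal.natCast_ne_top _
  rw [← ENNReal.mul_le_mul_iff_right hk0 hktop]
  calc (Fintype.card ι : ℝ≥0∞) * ∫⁻ x in S, f x ∂μ₀
      ≤ ENNReal.ofReal C * N * ∫⁻ x, f x ∂μ₀ := hmain
    _ = (Fintype.card ι : ℝ≥0∞) * (ENNReal.ofReal (C * N / Fintype.card ι) * ∫⁻ x, f x ∂μ₀) := by
        rw [← mul_assoc]
        congr 1
        have hk : (0 : ℝ) < Fintype.card ι := by exact_mod_cast hι
        rw [← ENNReal.ofReal_natCast (Fintype.card ι), ← ENNReal.ofReal_natCast N,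
          ← ENNReal.ofReal_mul hC, ← ENNReal.ofReal_mul (by positivity)]
        congr 1
        field_simp

end SparseTranslates

/-! ## §2 Why the visits are sparse: one-sided exit above the shell, and the grid count (Sketch §2) -/

section Exit

/-- **EXIT ABOVE.**  If along the orbit the ACTIVE plaquette's functional `g` satisfies the one-sided expansion
`g s ≥ g 0 + κ s − C₂ s²` on `[0, s₁]` ((T1) + (T1′)), starts in the shell (`g 0 ≥ θ(1 − ρ)`), and the tested
variable dominates it (`u ≥ g`: a sup over plaquettes), then `u ≥ θ` on `[2ρθ/κ, s₁] ∩ {C₂ s ≤ κ/2}`: the orbit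
has left the shell upwards and stays above.  No lower bound on any OTHER plaquette is used. [folklore] -/
theorem exit_above {g u : ℝ → ℝ} {κ C₂ θ ρ s₁ : ℝ} (hκ : 0 < κ) (hρθ : 0 ≤ ρ * θ)
    (hexp : ∀ s, 0 ≤ s → s ≤ s₁ → g 0 + κ * s - C₂ * s ^ 2 ≤ g s)
    (hstart : θ * (1 - ρ) ≤ g 0) (hdom : ∀ s, g s ≤ u s) :
    ∀ s, 2 * ρ * θ / κ ≤ s → s ≤ s₁ → C₂ * s ≤ κ / 2 → θ ≤ u s := by
  intro s hℓ hs₁ hcs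
  have hℓ0 : 0 ≤ 2 * ρ * θ / κ := div_nonneg (by linarith) hκ.le
  have hs0 : 0 ≤ s := le_trans hℓ0 hℓ
  have h1 : 2 * ρ * θ ≤ κ * s := by
    have := (div_le_iff₀ hκ).mp hℓ
    linarith
  have h2 : C₂ * s ^ 2 ≤ κ / 2 * s := by
    have := mul_le_mul_of_nonneg_right hcs hs0
    nlinarith
  have h3 := hexp s hs0 hs₁
  have h4 := hdom s
  nlinarith

end Exit

section Grid

/-- **GRID COUNT.**  A visit set `A ⊆ ℝ` with the GAP property «after a visit at `a`, no visit in
`[a + ℓ, a + ℓ + w]`» meets any arithmetic grid `s₀ + i·δ` (`i < m`, mesh `δ > 0`) of span `(m − 1)δ ≤ ℓ + w` in at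
most `⌊ℓ/δ⌋ + 1` points. [folklore] -/
theorem grid_count_le {A : Set ℝ} [DecidablePred (· ∈ A)] {ℓ w δ s₀ : ℝ} {m : ℕ} (hδ : 0 < δ) (hℓ : 0 ≤ ℓ)
    (hgap : ∀ a ∈ A, ∀ t, a + ℓ ≤ t → t ≤ a + ℓ + w → t ∉ A)
    (hspan : ((m : ℝ) - 1) * δ ≤ ℓ + w) :
    ((range m).filter fun i : ℕ => s₀ + (i : ℝ) * δ ∈ A).card ≤ ⌊ℓ / δ⌋₊ + 1 := by
  set I := (range m).filter fun i : ℕ => s₀ + (i : ℝ) * δ ∈ A with hI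
  by_cases hne : I.Nonempty
  · obtain ⟨i₀, hi₀, hmin⟩ := I.exists_min_image id hne
    have hi₀A : s₀ + (i₀ : ℝ) * δ ∈ A := (mem_filter.mp hi₀).2
    have hsub : I ⊆ Finset.Icc i₀ (i₀ + ⌊ℓ / δ⌋₊) := by
      intro i hi
      have him : i < m := mem_range.mp (mem_filter.mp hi).1
      have hiA : s₀ + (i : ℝ) * δ ∈ A := (mem_filter.mp hi).2
      have hge : i₀ ≤ i := hmin i hi
      rw [Finset.mem_Icc]
      refine ⟨hge, ?_⟩
      have hlt : ((i : ℝ) - i₀) * δ < ℓ := by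
        by_contra hcon
        push Not at hcon
        have hupper : ((i : ℝ) - i₀) * δ ≤ ℓ + w := by
          have h1 : ((i : ℕ) : ℝ) + 1 ≤ (m : ℝ) := by exact_mod_cast Nat.succ_le_of_lt him
          have h0 : (0 : ℝ) ≤ i₀ := Nat.cast_nonneg _
          have h2 : ((i : ℝ) - i₀) ≤ (m : ℝ) - 1 := by linarith
          calc ((i : ℝ) - i₀) * δ ≤ ((m : ℝ) - 1) * δ := mul_le_mul_of_nonneg_right h2 hδ.le
            _ ≤ ℓ + w := hspan
        exact hgap _ hi₀A (s₀ + (i : ℝ) * δ) (by linarith) (by linarith) hiA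
      have hcast : ((i - i₀ : ℕ) : ℝ) ≤ ℓ / δ := by
        rw [Nat.cast_sub hge]
        exact le_of_lt ((lt_div_iff₀ hδ).mpr hlt)
      have hfloor : i - i₀ ≤ ⌊ℓ / δ⌋₊ := (Nat.le_floor_iff (by positivity)).mpr hcast
      omega
    calc I.card ≤ (Finset.Icc i₀ (i₀ + ⌊ℓ / δ⌋₊)).card := card_le_card hsub
      _ = ⌊ℓ / δ⌋₊ + 1 := by
          rw [Nat.card_Icc]
          omega
  · rw [Finset.not_nonempty_iff_eq_empty] at hne
    rw [hne]
    simp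

/-- The gap property from the exit statement: if every visit is followed by a window `[a + ℓ, a + ℓ + w]` on
which the tested variable is `≥ θ`, and visits lie in `{U < θ}`, then no visit occurs in that window. [folklore] -/
theorem gap_of_exit {A : Set ℝ} {U : ℝ → ℝ} {θ ℓ w : ℝ}
    (hvis : A ⊆ {t | U t < θ}) (hexit : ∀ a ∈ A, ∀ t, a + ℓ ≤ t → t ≤ a + ℓ + w → θ ≤ U t) :
    ∀ a ∈ A, ∀ t, a + ℓ ≤ t → t ≤ a + ℓ + w → t ∉ A := by
  intro a ha t h1 h2 ht
  have := hvis ht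
  simp only [Set.mem_setOf_eq] at this
  linarith [hexit a ha t h1 h2]

end Grid

/-! ## §3 The menu: a coordinate direction within `1/√n`, and a large kernel entry nearby (Sketch §3) -/

section Menu

/-- **NET OF COORDINATE DIRECTIONS.**  For `v ∈ ℝⁿ` (`n ≥ 1`) some coordinate carries `v_i² ≥ |v|²/n`: testing the
`2n` signed coordinate directions of the Lie algebra loses only the factor `√n` in the one-sided transversality
constant. [folklore] -/
theorem exists_coord_sq_ge {n : ℕ} (hn : 0 < n) (v : Fin n → ℝ) : ∃ i, ∑ j, v j ^ 2 ≤ n * v i ^ 2 := by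
  have hne : (univ : Finset (Fin n)).Nonempty := univ_nonempty_iff.mpr ⟨⟨0, hn⟩⟩
  obtain ⟨i, -, hi⟩ := exists_max_image univ (fun j => v j ^ 2) hne
  refine ⟨i, ?_⟩
  calc ∑ j, v j ^ 2 ≤ ∑ _j : Fin n, v i ^ 2 := sum_le_sum fun j _ => hi j (mem_univ j)
    _ = n * v i ^ 2 := by simp

/-- **A LARGE ENTRY NEARBY.**  A response kernel `h` on a finite index set whose TOTAL is bounded below
(`|Σ h| ≥ c`) and whose TAIL off a finite set `s` of nearby bonds is small (`Σ_{∉ s}|h| ≤ c/2`) has an entry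
`≥ c/(2|s|)` inside `s` — the located input (T1) in its weakest form. [folklore] -/
theorem exists_large_entry {ι : Type*} [Fintype ι] [DecidableEq ι] (h : ι → ℝ) (s : Finset ι) (c : ℝ)
    (hs : s.Nonempty) (htot : c ≤ |∑ i, h i|) (htail : ∑ i ∈ sᶜ, |h i| ≤ c / 2) :
    ∃ i ∈ s, c / (2 * s.card) ≤ |h i| := by
  by_contra hcon
  push Not at hcon
  have hcard : (0 : ℝ) < s.card := by exact_mod_cast hs.card_pos
  have h1 : ∑ i ∈ s, |h i| < c / 2 := by
    calc ∑ i ∈ s, |h i| < ∑ _i ∈ s, c / (2 * s.card) := sum_lt_sum_of_nonempty hs fun i hi => hcon i hi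
      _ = c / 2 := by
          rw [sum_const, nsmul_eq_mul]
          field_simp
  have h2 : |∑ i, h i| ≤ ∑ i ∈ s, |h i| + ∑ i ∈ sᶜ, |h i| := by
    calc |∑ i, h i| ≤ ∑ i, |h i| := abs_sum_le_sum_abs _ _
      _ = ∑ i ∈ s, |h i| + ∑ i ∈ sᶜ, |h i| := (sum_add_sum_compl s _).symm
  linarith

end Menu

/-! ## §4 Assembly: the menu bound delivers `SlotAntiConcentration` BY NAME (Sketch §4) -/

section Assembly

/-- **(M1) FROM THE MENU.**  If the shell `{θ(1−ρ) ≤ u < θ}` is covered by finitely many pieces `S m`, each of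
measure `≤ a ×` the total mass, then `SlotAntiConcentration μ u θ ρ (|M|·a/ρ)`. [folklore] -/
theorem slotAntiConcentration_of_menu {Ω M : Type*} [MeasurableSpace Ω] [Fintype M] (μ : Measure Ω)
    (u : Ω → ℝ) {θ ρ a : ℝ} (hρ : 0 < ρ) (S : M → Set Ω)
    (hcover : {x | θ * (1 - ρ) ≤ u x ∧ u x < θ} ⊆ ⋃ m, S m) (hS : ∀ m, μ (S m) ≤ ENNReal.ofReal a * μ univ) :
    SlotAntiConcentration μ u θ ρ (Fintype.card M * a / ρ) := by
  unfold SlotAntiConcentration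
  have hDρ : (Fintype.card M : ℝ) * a / ρ * ρ = Fintype.card M * a := by field_simp
  rw [hDρ]
  calc μ {x | θ * (1 - ρ) ≤ u x ∧ u x < θ}
      ≤ μ (⋃ m, S m) := measure_mono hcover
    _ ≤ ∑ m, μ (S m) := measure_iUnion_fintype_le μ S
    _ ≤ ∑ _m : M, ENNReal.ofReal a * μ univ := sum_le_sum fun m _ => hS m
    _ = ENNReal.ofReal (Fintype.card M * a) * μ univ := by
        rw [sum_const, nsmul_eq_mul, Finset.card_univ, ← mul_assoc, ← ENNReal.ofReal_natCast,
          ← ENNReal.ofReal_mul (Nat.cast_nonneg _)]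

/-- **END TO END (abstract form of member (τ)).**  Menu pieces `S m`, each handled by its own finite family of
measure-preserving translates `e m i` with forward comparison constant `C` and sparsity `N` out of `|ι|` translates,
deliver `SlotAntiConcentration (μ₀.withDensity f) u θ ρ (|M|·(C·N/|ι|)/ρ)` from exactly `hcover`, `hmono`,
`hsparse`. [folklore] -/
theorem slotAntiConcentration_of_translates {Ω M ι : Type*} [MeasurableSpace Ω] [Fintype M] [Fintype ι]
    (μ₀ : Measure Ω) {f : Ω → ℝ≥0∞} (hf : Measurable f) (u : Ω → ℝ) {θ ρ C : ℝ} (hC : 0 ≤ C) (hρ : 0 < ρ)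
    (N : ℕ) (hι : 0 < Fintype.card ι) (S : M → Set Ω) (hSm : ∀ m, MeasurableSet (S m))
    (e : M → ι → Ω ≃ᵐ Ω) (he : ∀ m i, MeasurePreserving (e m i) μ₀ μ₀)
    (hcover : {x | θ * (1 - ρ) ≤ u x ∧ u x < θ} ⊆ ⋃ m, S m)
    (hmono : ∀ m i, ∀ x ∈ S m, f x ≤ ENNReal.ofReal C * f (e m i x))
    (hsparse : ∀ m y, ∑ i, ((e m i).symm ⁻¹' S m).indicator (fun _ => (1 : ℝ≥0∞)) y ≤ N) :
    SlotAntiConcentration (μ₀.withDensity f) u θ ρ (Fintype.card M * (C * N / Fintype.card ι) / ρ) :=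
  slotAntiConcentration_of_menu _ u hρ S hcover fun m =>
    withDensity_le_fraction μ₀ (e m) (he m) hf (hSm m) hC N hι (hmono m) (hsparse m)

end Assembly

end Summit.QuantumFields.BalabanUV.T4Continuum.ShellMeasureTranslate
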